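import Literature.IUT.HodgeArakelov.BadPrimeGaussianMonoidsCor36GenuineRecordInftyProofs
import Literature.IUT.HodgeArakelov.BadPrimeGaussianMonoidsGenuineRecordGaloisFamily
import Literature.IUT.HodgeArakelov.BadPrimeGaussianMonoidsGenuineRecordInftyFamily

/-!
# [IUTchII] Cor 3.6 (ii) «↷» at the genuine `θ_env` data of `X̲̲_K` for ANY family of inversion actions — in particular
# print's OUTER inversion `ι_Ÿ` (Rmk 1.4.1 (ii)): `Ψ`-level (exact) and `∞`-level (up to torsion), proof-only re-statement
# of `…Cor36GenuineRecordProofs` / `…Cor36GenuineRecordInftyProofs` together with their `∞`-binders `hsat` / `hΘU`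

S. Mochizuki, *Inter-universal Teichmüller theory II*, kurims Dec-2020 manuscript, Cor 3.6 (i) p. 99 l. 40–47 (the labeled
copies `(Ψ_{†C_v})_t` with their `G_v(M^Θ_*▶)_t`-actions and Kummer isomorphisms onto `Ψ_cns(M^Θ_*)_t`), Cor 3.6 (ii) p. 100
l. 23–26 («Thus, each monoid `Ψ_{Fξ}(†F_v)` is equipped with a natural action by `G_v(M^Θ_*▶)_{⟨F_l^⋇⟩}`»), Cor 3.5 (ii) p. 95
(bracket: the `N`-th roots are determined up to the `N`-torsion of `Ψ^×_cns`), Rmk 3.6.1 p. 101, Prop 3.1 (i)(ii) pp. 87–88,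
Rmk 1.4.1 (ii) p. 28 ("the unique order two `Δ^tp_{X̲̲_k}`-outer automorphism") [cite: Mochizuki2012, Cor 3.6 (ii) p.100];
classically [cite: NeukirchSchmidtWingberg2008, II §7] (torsion of the Kummer limit = classes of roots of unity). Claim key
DISPUTED (D-0012); nothing disputed is asserted here. PROOF-ONLY companion (abc-iut cell, layer L6, seat abc-iut-w5-d192
gen 4; node **IUTchII:Cor3.6(ii)** «↷», sub-DAG row Cor-36.ii.r9). NO definition, NO `Prop` fact, NO instance.

WHY THIS FILE. This lineage's genuine-record theorems of record — `kummer_smul_restriction_eq_thetaEnvRecordKummer`,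
`cor36ii_psi_thetaEnvRecordKummer_of_mem_thetaEnv` (p430555), `cor36ii_infty_thetaEnvRecordKummer_of_mem_thetaEnv` (p431816)
and their `∞`-binders `hsat_thetaEnvRecordKummer` / `hThetaU_thetaEnvRecordKummer` (p428301) — are stated for abc-iut-w4-d019's
v1 record `EtaleLevels.thetaEnvRecordKummer … ι₀`, whose "inversions" are the conjugates of the INNER action of an element
`ι₀ ∈ Π^tp_{X̲̲}`: by abc-iut-w4-d019's own reading correction (v2 note of `ThetaEnvDataRecordModel.lean`) a DEGENERATE choice —
print's `ι_Ÿ` is OUTER (Rmk 1.4.1 (ii)). Every proof depends on the record only through abc-iut-w4-d019's bridge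
`ThetaEnvData.toRecord` (ambient module `lim_J H¹(Π^tp_{Ÿ̲̲} ∩ J, l·Δ_Θ)`, `conj = h1LimConjMulAut`, `Ψ_cns = κ(O)` by `rfl`,
`toRecord_topClass`) and NOT on the inversion family. HERE the same theorems are stated for the record
`(EtaleLevels.thetaEnvData …).toRecord (h1LimConjMulAut …) (h1LimKummerOn c hA hfi O) iota` with an ARBITRARY family
`iota : Iota → (lim ≃+ lim)` of inversion actions (abc-iut-w4-d030's shape), exactly as abc-iut-w4-d004 gen 3 did for every
Cor 3.5 (ii) clause (`…GenuineRecordRestrictionIsoFamily` p432177, `…GenuineRecordGaloisFamily`, `…GenuineRecordInftyFamily`,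
consumed here BY NAME), so that they apply verbatim to the print-faithful family of `Π^tp_{X̲̲}`-conjugates of one outer
pointed inversion as soon as a consumer fixes it:
* §1 `constantMonoid_stable_toRecord_family`, `units_stable_toRecord_family` (Prop 3.1 (ii): `Ψ_cns`, `M^×_TM` conjugation-
  stable), `hsat_toRecord_family` (`M^×_TM` SATURATED in the ambient module, from `c` bijective + `O ⊇ torsion(A)` + `O`
  root-closed), **`hThetaU_toRecord_family`** (the `∞`-binder `hΘU` from print's root condition `hroots`; `hfix` and the
  unit-stability DERIVED);
* §2 `kummer_smul_restriction_eq_toRecord_family` (the labeled Kummer maps `f_t := R_t ∘ κ` are `G_v`-equivariant) and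
  **`cor36ii_psi_toRecord_family_of_mem_thetaEnv`** — the `Ψ`-level «↷», EXACT, the copies `(Ψ_{†C_v})_t` read as `O`
  (J5 for the genuine `†F_v`), junction = abc-iut-w4-d004 `mrange_pi_diagonalStable'_toRecord_of_mem_thetaEnv`;
* §3 **`cor36ii_infty_toRecord_family_of_mem_thetaEnv`** — the `∞`-level «↷» in the FAITHFUL form (up to a family of ROOTS OF
  UNITY of `O`), junction = abc-iut-w4-d004 `pi_restriction_inftyThetaMonoid_upToTorsion_toRecord_of_mem_thetaEnv`, with
  abc-iut-w5-d131 `splitMonoid_closure_conjStable` and abc-iut-w5-d098 `exists_h1LimKummer_eq_of_isOfFinAddOrder`.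
Inputs (unchanged from the v1 files, none about the inversion family): the evaluation-sections DATA (`s_t` continuous into
`Π^tp_{Ÿ̲̲}`, common `φ₀`, sections of an augmentation `q` whose kernel acts trivially on `O`, restrictions `R_t` pinned),
`θ ∈ θ^{i₀}_env(𝕄_*)`, model data (`c` bijective, `O` `Π`-stable ⊇ torsion, root-closed), and for the `∞`-level print's root
condition `hroots`. The corollaries for print's `O := 𝒪^▷_{ℚ̄_p}` through `ε` are the sequel `…Cor36GenuineRecordFamilyOfTower`.
HONEST FRAMING: composition of landed theorems; no side taken on [IUTchIII] Cor 3.12; typed ≠ proved ≠ endorsed.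
-/

noncomputable section

namespace Literature.IUT.HodgeArakelov

namespace EtaleLevels

open Literature.AnabelianGeometry.EtaleTheta CohomologySystemOfContH1 EtaleThetaDataOfSetting TemperedThetaMonoids
  BadPrimeGaussianMonoids

variable {p : ℕ} [Fact p.Prime] {D : Literature.AnabelianGeometry.EtaleTheta.ThetaSetting p}
  {E : D.EtaleThetaData} {l : ℕ} (C : E.DoubleUnderline l) (hC : D.Compat) (hS : D.Sec2Hyps)
  (hl : l.Prime) (hp2 : p ≠ 2) (hpl : p ≠ l) (hζ : ∃ ζ : D.K, IsPrimitiveRoot ζ (4 * l))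
  (mods : ∀ M : ℕ+, D.CyclotomeMod l M)
  (f : contCocycles D.toTheta D.DeltaTheta C.GtpYdduu) (hf : f ∈ C.rootCocycles hC)
  (hmods : ∀ (M M' : ℕ+) (h : (M : ℕ) ∣ (M' : ℕ)) (x : D.lDeltaTheta l),
    MuN.red p M M' h ((mods M').red x) = (mods M).red x)
  (h15 : Literature.AnabelianGeometry.EtaleTheta.ThetaSetting.Prop15iii E hC) (L : C.CuspLabels)
  (hZ : ∀ M : ℕ+, Nonempty (ModelCyclotomes.lDeltaQuot (C.rigidData (mods M) hC hS h15 L) ≃*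
    Literature.IUT.HodgeTheaters.ZHat))
  (hcharY : EtaleThetaDataOfSetting.PiYddCharacteristic C)
  (hlim : Function.Bijective (rigidLimHom C hC hS hl hp2 hpl hζ mods f hf hmods h15 L hZ))
  [(EtaleThetaDataOfSetting.PiYdd C).Normal]
  {A : Type} [CommGroup A] [MulDistribMulAction (Pi C) A] [TopologicalSpace A] [RootableBy A ℕ]
  (c : CyclotomeCoefficients (phi C) (D.lDeltaTheta l) A)
  (hA : ∀ b : A, IsOpen (MulAction.stabilizer (Pi C) b : Set (Pi C)))
  (hfi : ∀ b : A, (MulAction.stabilizer (Pi C) b).FiniteIndex)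
  (O : Submonoid A) (hO : ∀ (σ : Pi C) (b : A), b ∈ O → σ • b ∈ O)
  {Iota : Type}
  (iota : Iota → ((thetaEnvData C hC hS hl hp2 hpl hζ mods f hf hmods h15 L hZ hcharY hlim).D.coh.lim ≃+
    (thetaEnvData C hC hS hl hp2 hpl hζ mods f hf hmods h15 L hZ hcharY hlim).D.coh.lim))
  {Lbl : Type*} {P₀ : TopGroup.{0}} (φ₀ : P₀ →* D.GtpTheta) (s : Lbl → (P₀ →* Pi C))
  (hι : ∀ t, Continuous ((MonoidHom.id (Pi C)).comp (s t)))
  (hN : ∀ t, (⊤ : Subgroup P₀).map ((MonoidHom.id (Pi C)).comp (s t)) ≤ PiYdd C)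
  (hφ : ∀ t, (phi C).comp ((MonoidHom.id (Pi C)).comp (s t)) = φ₀)

/-! ### §1. `Ψ_cns`, `M^×_TM` conjugation-stable; `M^×_TM` saturated; the `∞`-binder `hΘU` — any inversion family -/

include hcharY hO in
/-- **`Ψ_cns = κ(O)` is conjugation-stable** for the record with ANY inversion family ([IUTchII] Prop 3.1 (ii) p. 88 «equipped
with a natural conjugation action by `Π_X(M^Θ_*)`»): equivariance of abc-iut-w4-d007's Kummer map (`h1LimKummerOn_smul`) and
`Π`-stability of `O`; the inversion family is not involved. [cite: Mochizuki2012, Prop 3.1 (ii) p.88] -/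
theorem constantMonoid_stable_toRecord_family :
    ((thetaEnvData C hC hS hl hp2 hpl hζ mods f hf hmods h15 L hZ hcharY hlim).toRecord
        (h1LimConjMulAut (phi C) (D.lDeltaTheta l) (PiYdd C)) (h1LimKummerOn (phi C) (D.lDeltaTheta l) (PiYdd C) c hA hfi O)
        iota).IsConjStable
      ((thetaEnvData C hC hS hl hp2 hpl hζ mods f hf hmods h15 L hZ hcharY hlim).toRecord
        (h1LimConjMulAut (phi C) (D.lDeltaTheta l) (PiYdd C)) (h1LimKummerOn (phi C) (D.lDeltaTheta l) (PiYdd C) c hA hfi O)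
        iota).constantMonoid := by
  intro g' x hx
  let g : Pi C := g'
  change x ∈ MonoidHom.mrange _ at hx
  obtain ⟨m, rfl⟩ := hx
  change h1LimConjMulAut (phi C) (D.lDeltaTheta l) (PiYdd C) g (h1LimKummerOn (phi C) (D.lDeltaTheta l) (PiYdd C) c hA hfi O m) ∈ MonoidHom.mrange _
  exact ⟨⟨g • (m : A), hO g m m.2⟩, h1LimKummerOn_smul (phi C) (D.lDeltaTheta l) (PiYdd C) c hA hfi O g m ⟨g • (m : A), hO g m m.2⟩ rfl⟩

include hcharY hO in
/-- **`M^×_TM` is conjugation-stable** for the record with ANY inversion family (units of the stable `Ψ_cns`; abc-iut-w4-d019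
`ThetaEnvData.toRecord_units_stable`). [cite: Mochizuki2012, Prop 3.1 (ii) p.88] -/
theorem units_stable_toRecord_family (g : Pi C) (x : ((thetaEnvData C hC hS hl hp2 hpl hζ mods f hf hmods h15 L hZ hcharY hlim).toRecord
        (h1LimConjMulAut (phi C) (D.lDeltaTheta l) (PiYdd C)) (h1LimKummerOn (phi C) (D.lDeltaTheta l) (PiYdd C) c hA hfi O)
        iota).H) (hx : x ∈ ((thetaEnvData C hC hS hl hp2 hpl hζ mods f hf hmods h15 L hZ hcharY hlim).toRecord
        (h1LimConjMulAut (phi C) (D.lDeltaTheta l) (PiYdd C)) (h1LimKummerOn (phi C) (D.lDeltaTheta l) (PiYdd C) c hA hfi O)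
        iota).units) :
    ((thetaEnvData C hC hS hl hp2 hpl hζ mods f hf hmods h15 L hZ hcharY hlim).toRecord
        (h1LimConjMulAut (phi C) (D.lDeltaTheta l) (PiYdd C)) (h1LimKummerOn (phi C) (D.lDeltaTheta l) (PiYdd C) c hA hfi O)
        iota).conj g x ∈ ((thetaEnvData C hC hS hl hp2 hpl hζ mods f hf hmods h15 L hZ hcharY hlim).toRecord
        (h1LimConjMulAut (phi C) (D.lDeltaTheta l) (PiYdd C)) (h1LimKummerOn (phi C) (D.lDeltaTheta l) (PiYdd C) c hA hfi O)
        iota).units :=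
  (thetaEnvData C hC hS hl hp2 hpl hζ mods f hf hmods h15 L hZ hcharY hlim).toRecord_units_stable _ _ _
    (constantMonoid_stable_toRecord_family C hC hS hl hp2 hpl hζ mods f hf hmods h15 L hZ hcharY hlim c hA hfi O hO iota) g x hx

/-- **`M^×_TM` is SATURATED in the ambient module** for the record with ANY inversion family: `x ^ n ∈ M^×_TM`, `0 < n` ⇒
`x ∈ M^×_TM`, for bijective cyclotomic-rigidity coefficients `c` and a constant monoid `O` ("`𝒪^▷_{k̄}`") containing the roots of
unity and root-closed in `A` ("`k̄ˣ`") — this lineage's `units_of_pow_mem_units_ofKummerModel` (p428301) at `ψ = id`,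
`κ = h1LimKummerOn` by `rfl`. [cite: NeukirchSchmidtWingberg2008, II §7] -/
theorem hsat_toRecord_family (hc : Function.Bijective c.hom)
    (hOtors : ∀ a : A, IsOfFinOrder a → a ∈ O ∧ a⁻¹ ∈ O)
    (hOroot : ∀ (a : A) (n : ℕ), 0 < n → a ^ n ∈ O → a ∈ O) :
    ∀ (x : ((thetaEnvData C hC hS hl hp2 hpl hζ mods f hf hmods h15 L hZ hcharY hlim).toRecord
        (h1LimConjMulAut (phi C) (D.lDeltaTheta l) (PiYdd C)) (h1LimKummerOn (phi C) (D.lDeltaTheta l) (PiYdd C) c hA hfi O)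
        iota).H) (n : ℕ), 0 < n → x ^ n ∈ ((thetaEnvData C hC hS hl hp2 hpl hζ mods f hf hmods h15 L hZ hcharY hlim).toRecord
        (h1LimConjMulAut (phi C) (D.lDeltaTheta l) (PiYdd C)) (h1LimKummerOn (phi C) (D.lDeltaTheta l) (PiYdd C) c hA hfi O)
        iota).units → x ∈ ((thetaEnvData C hC hS hl hp2 hpl hζ mods f hf hmods h15 L hZ hcharY hlim).toRecord
        (h1LimConjMulAut (phi C) (D.lDeltaTheta l) (PiYdd C)) (h1LimKummerOn (phi C) (D.lDeltaTheta l) (PiYdd C) c hA hfi O)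
        iota).units :=
  fun x n hn hx => BadPrimeGaussianMonoids.units_of_pow_mem_units_ofKummerModel
    ((thetaEnvData C hC hS hl hp2 hpl hζ mods f hf hmods h15 L hZ hcharY hlim).toRecord
        (h1LimConjMulAut (phi C) (D.lDeltaTheta l) (PiYdd C)) (h1LimKummerOn (phi C) (D.lDeltaTheta l) (PiYdd C) c hA hfi O)
        iota)
    (phi C) (D.lDeltaTheta l) (PiYdd C) c hA hfi (MulEquiv.refl _) O (h1LimKummerOn (phi C) (D.lDeltaTheta l) (PiYdd C) c hA hfi O) (fun _ => rfl)
    (ThetaEnvData.toRecord_constantMonoid _ _ _ _) hc (fun a ha => (hOtors a ha).1) hOroot x n hn hx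

include hcharY hO hN in
/-- **`hΘU` for the record with ANY inversion family** ([IUTchII] Cor 3.5 (ii) p. 95 bracket; the binder `hΘU` of
abc-iut-w5-d131's `inftyThetaMonoid_conjStable_of_kummer`, in its labeled shape): for every family of evaluation sections
`s_t : Π₀ → Π^tp_{X̲̲}` with images in `Π^tp_{Ÿ̲̲}`, every `θ ∈ θ^{i₀}_env(𝕄_*)` (any `iota`, any `i₀`) and every label `i`: for
all `g`, `t` and `ϑ ∈ ∞θ^{i}_env`, `conj (s_t g) ϑ = u · ϑ` with `u ∈ M^×_TM`. Inputs = model data (`hc`, `hO`, `hOtors`,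
`hOroot`) + print's root condition `hroots` relative to `θ`; `hfix` (abc-iut-w4-d004 `conj_section_eq_self_labelwise` with
`topClass_toRecord_family`), the unit-stability and `hsat` are DERIVED above. [cite: Mochizuki2012, Cor 3.5 (ii) p.95] -/
theorem hThetaU_toRecord_family (hc : Function.Bijective c.hom)
    (hOtors : ∀ a : A, IsOfFinOrder a → a ∈ O ∧ a⁻¹ ∈ O)
    (hOroot : ∀ (a : A) (n : ℕ), 0 < n → a ^ n ∈ O → a ∈ O) {i₀ : Iota}
    {θ : ((thetaEnvData C hC hS hl hp2 hpl hζ mods f hf hmods h15 L hZ hcharY hlim).toRecord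
        (h1LimConjMulAut (phi C) (D.lDeltaTheta l) (PiYdd C)) (h1LimKummerOn (phi C) (D.lDeltaTheta l) (PiYdd C) c hA hfi O)
        iota).H}
    (hθ : θ ∈ ((thetaEnvData C hC hS hl hp2 hpl hζ mods f hf hmods h15 L hZ hcharY hlim).toRecord
        (h1LimConjMulAut (phi C) (D.lDeltaTheta l) (PiYdd C)) (h1LimKummerOn (phi C) (D.lDeltaTheta l) (PiYdd C) c hA hfi O)
        iota).thetaEnv i₀)
    (i : ((thetaEnvData C hC hS hl hp2 hpl hζ mods f hf hmods h15 L hZ hcharY hlim).toRecord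
        (h1LimConjMulAut (phi C) (D.lDeltaTheta l) (PiYdd C)) (h1LimKummerOn (phi C) (D.lDeltaTheta l) (PiYdd C) c hA hfi O)
        iota).Iota)
    (hroots : ∀ ϑ ∈ ((thetaEnvData C hC hS hl hp2 hpl hζ mods f hf hmods h15 L hZ hcharY hlim).toRecord
        (h1LimConjMulAut (phi C) (D.lDeltaTheta l) (PiYdd C)) (h1LimKummerOn (phi C) (D.lDeltaTheta l) (PiYdd C) c hA hfi O)
        iota).inftyThetaEnv i,
      ∃ n : ℕ, 0 < n ∧ ϑ ^ n ∈
        splitMonoid ((thetaEnvData C hC hS hl hp2 hpl hζ mods f hf hmods h15 L hZ hcharY hlim).toRecord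
        (h1LimConjMulAut (phi C) (D.lDeltaTheta l) (PiYdd C)) (h1LimKummerOn (phi C) (D.lDeltaTheta l) (PiYdd C) c hA hfi O)
        iota).units
          (Submonoid.powers θ)) :
    ∀ (g : P₀) (t : Lbl),
      ∀ ϑ ∈ ((thetaEnvData C hC hS hl hp2 hpl hζ mods f hf hmods h15 L hZ hcharY hlim).toRecord
        (h1LimConjMulAut (phi C) (D.lDeltaTheta l) (PiYdd C)) (h1LimKummerOn (phi C) (D.lDeltaTheta l) (PiYdd C) c hA hfi O)
        iota).inftyThetaEnv i,
        ∃ u ∈ ((thetaEnvData C hC hS hl hp2 hpl hζ mods f hf hmods h15 L hZ hcharY hlim).toRecord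
        (h1LimConjMulAut (phi C) (D.lDeltaTheta l) (PiYdd C)) (h1LimKummerOn (phi C) (D.lDeltaTheta l) (PiYdd C) c hA hfi O)
        iota).units,
          ((thetaEnvData C hC hS hl hp2 hpl hζ mods f hf hmods h15 L hZ hcharY hlim).toRecord
        (h1LimConjMulAut (phi C) (D.lDeltaTheta l) (PiYdd C)) (h1LimKummerOn (phi C) (D.lDeltaTheta l) (PiYdd C) c hA hfi O)
        iota).conj (s t g) ϑ =
            u * ϑ := by
  have hfix : ∀ (g : P₀) (t : Lbl),
      ((thetaEnvData C hC hS hl hp2 hpl hζ mods f hf hmods h15 L hZ hcharY hlim).toRecord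
        (h1LimConjMulAut (phi C) (D.lDeltaTheta l) (PiYdd C)) (h1LimKummerOn (phi C) (D.lDeltaTheta l) (PiYdd C) c hA hfi O)
        iota).conj (s t g) θ = θ :=
    conj_section_eq_self_labelwise
      ((thetaEnvData C hC hS hl hp2 hpl hζ mods f hf hmods h15 L hZ hcharY hlim).toRecord
        (h1LimConjMulAut (phi C) (D.lDeltaTheta l) (PiYdd C)) (h1LimKummerOn (phi C) (D.lDeltaTheta l) (PiYdd C) c hA hfi O)
        iota)
      (phi C) (D.lDeltaTheta l) (PiYdd C) (MonoidHom.id (Pi C))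
      (AddEquiv.additiveMultiplicative (h1Lim (phi C) (D.lDeltaTheta l) (PiYdd C) ⊥)) s hN (fun _ _ => rfl)
      (topClass_toRecord_family C hC hS hl hp2 hpl hζ mods f hf hmods h15 L hZ hcharY hlim c hA hfi O iota hθ)
  exact ((thetaEnvData C hC hS hl hp2 hpl hζ mods f hf hmods h15 L hZ hcharY hlim).toRecord
        (h1LimConjMulAut (phi C) (D.lDeltaTheta l) (PiYdd C)) (h1LimKummerOn (phi C) (D.lDeltaTheta l) (PiYdd C) c hA hfi O)
        iota).hThetaU_of_hroots_labelwise
    (fun t g => s t g) i hroots hfix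
    (fun q u hu => units_stable_toRecord_family C hC hS hl hp2 hpl hζ mods f hf hmods h15 L hZ hcharY hlim c hA hfi O hO iota q u hu)
    (hsat_toRecord_family C hC hS hl hp2 hpl hζ mods f hf hmods h15 L hZ hcharY hlim c hA hfi O iota hc hOtors hOroot)

/-! ### §2. `Ψ`-level «↷», exact — any inversion family -/

/-- **The labeled Kummer maps `f_t := R_t ∘ κ : O → lim H¹(Π₀ ∩ ·, l·Δ_Θ)_{φ₀}` are `G_v`-EQUIVARIANT** for the record with ANY
inversion family ([IUTchII] Cor 3.6 (i) p. 99 l. 40–47: `G_v(M^Θ_*▶)_t ↷ (Ψ_{†C_v})_t ⥲ Ψ_cns(M^Θ_*)_t` «compatible with the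
respective conjugation actions»): abc-iut-w4-d007 `h1LimKummerOn_smul` + abc-iut-w4-d004 `restriction_conj_section_eq_labelwise`.
[cite: Mochizuki2012, Cor 3.6 (i) p.99] -/
theorem kummer_smul_restriction_eq_toRecord_family
    (R : Lbl → (((thetaEnvData C hC hS hl hp2 hpl hζ mods f hf hmods h15 L hZ hcharY hlim).toRecord
        (h1LimConjMulAut (phi C) (D.lDeltaTheta l) (PiYdd C)) (h1LimKummerOn (phi C) (D.lDeltaTheta l) (PiYdd C) c hA hfi O)
        iota).H →*
      Multiplicative (h1Lim φ₀ (D.lDeltaTheta l) (⊤ : Subgroup P₀) ⊥)))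
    (hR : ∀ t y, Multiplicative.toAdd (R t y) =
      h1LimCongr (D.lDeltaTheta l) ⊤ (hφ t) ⊥
        (h1LimComap (phi C) (D.lDeltaTheta l) ((MonoidHom.id (Pi C)).comp (s t)) (hι t) (hN t)
          (AddEquiv.additiveMultiplicative (h1Lim (phi C) (D.lDeltaTheta l) (PiYdd C) ⊥) (Additive.ofMul y))))
    (t : Lbl) (g : P₀) (o : O) :
    R t (h1LimKummerOn (phi C) (D.lDeltaTheta l) (PiYdd C) c hA hfi O ⟨(s t g) • (o : A), hO (s t g) (o : A) o.2⟩) =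
      h1LimConjMulAut φ₀ (D.lDeltaTheta l) ⊤ g (R t (h1LimKummerOn (phi C) (D.lDeltaTheta l) (PiYdd C) c hA hfi O o)) := by
  have h1 : h1LimKummerOn (phi C) (D.lDeltaTheta l) (PiYdd C) c hA hfi O ⟨(s t g) • (o : A), hO (s t g) (o : A) o.2⟩ =
      ((thetaEnvData C hC hS hl hp2 hpl hζ mods f hf hmods h15 L hZ hcharY hlim).toRecord
        (h1LimConjMulAut (phi C) (D.lDeltaTheta l) (PiYdd C)) (h1LimKummerOn (phi C) (D.lDeltaTheta l) (PiYdd C) c hA hfi O)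
        iota).conj (s t g)
        (h1LimKummerOn (phi C) (D.lDeltaTheta l) (PiYdd C) c hA hfi O o) :=
    h1LimKummerOn_smul (phi C) (D.lDeltaTheta l) (PiYdd C) c hA hfi O (s t g) o _ rfl
  rw [h1]
  exact restriction_conj_section_eq_labelwise
    ((thetaEnvData C hC hS hl hp2 hpl hζ mods f hf hmods h15 L hZ hcharY hlim).toRecord
        (h1LimConjMulAut (phi C) (D.lDeltaTheta l) (PiYdd C)) (h1LimKummerOn (phi C) (D.lDeltaTheta l) (PiYdd C) c hA hfi O)
        iota)
    (phi C) φ₀ (D.lDeltaTheta l) (PiYdd C) (MonoidHom.id (Pi C))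
    (AddEquiv.additiveMultiplicative (h1Lim (phi C) (D.lDeltaTheta l) (PiYdd C) ⊥)) s hι hN hφ (fun _ _ => rfl) R hR t g _

/-- **[IUTchII] Cor 3.6 (ii) «↷», `Ψ`-LEVEL, EXACT, at the genuine `θ_env` data with ANY inversion family `iota`** (p. 100 l. 23–26
«each monoid `Ψ_{Fξ}(†F_v)` is equipped with a natural action by `G_v(M^Θ_*▶)_{⟨F_l^⋇⟩}`»), the copies `(Ψ_{†C_v})_t` read as `O`:
for every `θ ∈ θ^{i₀}_env(𝕄_*)` and every tuple `x : Lbl → O` whose labeled Kummer classes `(R_t κ(x_t))_t` lie in the Gaussian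
monoid `Ψ_ξ(θ) = ∏ R_t(M^×_TM · θ^ℕ)`, the translated tuple `(s_t(g) · x_t)_t` has the same property. Inputs = the evaluation-
sections data + model data; the Cor 3.5 (ii) junction is abc-iut-w4-d004's `mrange_pi_diagonalStable'_toRecord_of_mem_thetaEnv`.
[cite: Mochizuki2012, Cor 3.6 (ii) p.100] -/
theorem cor36ii_psi_toRecord_family_of_mem_thetaEnv
    {K : Type*} [Group K] (q : Pi C →* K) (hq : ∀ x : Pi C, q x = 1 → ∀ a ∈ O, x • a = a) (w : P₀ →* K)
    (hsec : ∀ t g, q (s t g) = w g) {i₀ : Iota}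
    {θ : ((thetaEnvData C hC hS hl hp2 hpl hζ mods f hf hmods h15 L hZ hcharY hlim).toRecord
        (h1LimConjMulAut (phi C) (D.lDeltaTheta l) (PiYdd C)) (h1LimKummerOn (phi C) (D.lDeltaTheta l) (PiYdd C) c hA hfi O)
        iota).H}
    (hθ : θ ∈ ((thetaEnvData C hC hS hl hp2 hpl hζ mods f hf hmods h15 L hZ hcharY hlim).toRecord
        (h1LimConjMulAut (phi C) (D.lDeltaTheta l) (PiYdd C)) (h1LimKummerOn (phi C) (D.lDeltaTheta l) (PiYdd C) c hA hfi O)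
        iota).thetaEnv i₀)
    (R : Lbl → (((thetaEnvData C hC hS hl hp2 hpl hζ mods f hf hmods h15 L hZ hcharY hlim).toRecord
        (h1LimConjMulAut (phi C) (D.lDeltaTheta l) (PiYdd C)) (h1LimKummerOn (phi C) (D.lDeltaTheta l) (PiYdd C) c hA hfi O)
        iota).H →*
      Multiplicative (h1Lim φ₀ (D.lDeltaTheta l) (⊤ : Subgroup P₀) ⊥)))
    (hR : ∀ t y, Multiplicative.toAdd (R t y) =
      h1LimCongr (D.lDeltaTheta l) ⊤ (hφ t) ⊥
        (h1LimComap (phi C) (D.lDeltaTheta l) ((MonoidHom.id (Pi C)).comp (s t)) (hι t) (hN t)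
          (AddEquiv.additiveMultiplicative (h1Lim (phi C) (D.lDeltaTheta l) (PiYdd C) ⊥) (Additive.ofMul y))))
    (t₀ : Lbl) (g : P₀) {x : Lbl → O}
    (hx : (fun t => R t (h1LimKummerOn (phi C) (D.lDeltaTheta l) (PiYdd C) c hA hfi O (x t))) ∈
      MonoidHom.mrange (MonoidHom.pi fun t => (R t).comp (splitMonoid
        ((thetaEnvData C hC hS hl hp2 hpl hζ mods f hf hmods h15 L hZ hcharY hlim).toRecord
        (h1LimConjMulAut (phi C) (D.lDeltaTheta l) (PiYdd C)) (h1LimKummerOn (phi C) (D.lDeltaTheta l) (PiYdd C) c hA hfi O)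
        iota).units
        (Submonoid.powers θ)).subtype)) :
    (fun t => R t (h1LimKummerOn (phi C) (D.lDeltaTheta l) (PiYdd C) c hA hfi O
        ⟨(s t g) • ((x t : O) : A), hO (s t g) _ (x t).2⟩)) ∈
      MonoidHom.mrange (MonoidHom.pi fun t => (R t).comp (splitMonoid
        ((thetaEnvData C hC hS hl hp2 hpl hζ mods f hf hmods h15 L hZ hcharY hlim).toRecord
        (h1LimConjMulAut (phi C) (D.lDeltaTheta l) (PiYdd C)) (h1LimKummerOn (phi C) (D.lDeltaTheta l) (PiYdd C) c hA hfi O)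
        iota).units
        (Submonoid.powers θ)).subtype) := by
  have key : (fun t => R t (h1LimKummerOn (phi C) (D.lDeltaTheta l) (PiYdd C) c hA hfi O
      ⟨(s t g) • ((x t : O) : A), hO (s t g) _ (x t).2⟩)) =
      piIso Lbl (h1LimConjMulAut φ₀ (D.lDeltaTheta l) ⊤ g)
        (fun t => R t (h1LimKummerOn (phi C) (D.lDeltaTheta l) (PiYdd C) c hA hfi O (x t))) := by
    funext t
    exact kummer_smul_restriction_eq_toRecord_family C hC hS hl hp2 hpl hζ mods f hf hmods h15 L hZ hcharY hlim c hA hfi O hO iota φ₀ s hι hN hφ R hR t g (x t)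
  rw [key]
  exact mem_of_map_piIso_eq
    (mrange_pi_diagonalStable'_toRecord_of_mem_thetaEnv C hC hS hl hp2 hpl hζ mods f hf hmods h15 L hZ hcharY hlim c hA hfi O hO iota φ₀ s hι hN hφ q hq w hsec hθ R hR t₀ g) hx

/-! ### §3. `∞`-level «↷», faithful form up to torsion — any inversion family -/

/-- **[IUTchII] Cor 3.6 (ii) «↷», `∞`-LEVEL, FAITHFUL FORM UP TO TORSION, at the genuine `θ_env` data with ANY inversion family
`iota`** (p. 100 `∞`-row with Cor 3.5 (ii) p. 95 bracket l. 3–7 and Rmk 3.6.1 p. 101), the copies read as `O`: for every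
`θ ∈ θ^{i₀}_env(𝕄_*)`, every label `i` with print's root condition `hroots` on `∞θ^{i}_env` relative to `θ`, and every tuple
`y : Lbl → O` whose labeled Kummer classes lie in `∏ R_t(∞Ψ^{i}_env)`, the translated tuple `(s_t(g) · y_t)_t` lies there again UP
TO a family `(v_t)_t` of ROOTS OF UNITY of `O`. Inputs = sections data + model data (`hc`, `hO`, `hOtors`, `hOroot`) + `hroots`;
the junctions are abc-iut-w4-d004's `pi_restriction_inftyThetaMonoid_upToTorsion_toRecord_of_mem_thetaEnv`, §1's
`hThetaU_toRecord_family`, abc-iut-w5-d131's `splitMonoid_closure_conjStable`, and the torsion classes are Kummer classes of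
roots of unity (abc-iut-w5-d098). [cite: Mochizuki2012, Cor 3.6 (ii) p.100] -/
theorem cor36ii_infty_toRecord_family_of_mem_thetaEnv (hc : Function.Bijective c.hom)
    (hOtors : ∀ a : A, IsOfFinOrder a → a ∈ O ∧ a⁻¹ ∈ O)
    (hOroot : ∀ (a : A) (n : ℕ), 0 < n → a ^ n ∈ O → a ∈ O)
    {K : Type*} [Group K] (q : Pi C →* K) (hq : ∀ x : Pi C, q x = 1 → ∀ a ∈ O, x • a = a) (w : P₀ →* K)
    (hsec : ∀ t g, q (s t g) = w g) {i₀ : Iota}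
    {θ : ((thetaEnvData C hC hS hl hp2 hpl hζ mods f hf hmods h15 L hZ hcharY hlim).toRecord
        (h1LimConjMulAut (phi C) (D.lDeltaTheta l) (PiYdd C)) (h1LimKummerOn (phi C) (D.lDeltaTheta l) (PiYdd C) c hA hfi O)
        iota).H}
    (hθ : θ ∈ ((thetaEnvData C hC hS hl hp2 hpl hζ mods f hf hmods h15 L hZ hcharY hlim).toRecord
        (h1LimConjMulAut (phi C) (D.lDeltaTheta l) (PiYdd C)) (h1LimKummerOn (phi C) (D.lDeltaTheta l) (PiYdd C) c hA hfi O)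
        iota).thetaEnv i₀)
    (i : ((thetaEnvData C hC hS hl hp2 hpl hζ mods f hf hmods h15 L hZ hcharY hlim).toRecord
        (h1LimConjMulAut (phi C) (D.lDeltaTheta l) (PiYdd C)) (h1LimKummerOn (phi C) (D.lDeltaTheta l) (PiYdd C) c hA hfi O)
        iota).Iota)
    (hroots : ∀ ϑ ∈ ((thetaEnvData C hC hS hl hp2 hpl hζ mods f hf hmods h15 L hZ hcharY hlim).toRecord
        (h1LimConjMulAut (phi C) (D.lDeltaTheta l) (PiYdd C)) (h1LimKummerOn (phi C) (D.lDeltaTheta l) (PiYdd C) c hA hfi O)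
        iota).inftyThetaEnv i,
      ∃ n : ℕ, 0 < n ∧ ϑ ^ n ∈
        splitMonoid ((thetaEnvData C hC hS hl hp2 hpl hζ mods f hf hmods h15 L hZ hcharY hlim).toRecord
        (h1LimConjMulAut (phi C) (D.lDeltaTheta l) (PiYdd C)) (h1LimKummerOn (phi C) (D.lDeltaTheta l) (PiYdd C) c hA hfi O)
        iota).units
          (Submonoid.powers θ))
    (R : Lbl → (((thetaEnvData C hC hS hl hp2 hpl hζ mods f hf hmods h15 L hZ hcharY hlim).toRecord
        (h1LimConjMulAut (phi C) (D.lDeltaTheta l) (PiYdd C)) (h1LimKummerOn (phi C) (D.lDeltaTheta l) (PiYdd C) c hA hfi O)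
        iota).H →*
      Multiplicative (h1Lim φ₀ (D.lDeltaTheta l) (⊤ : Subgroup P₀) ⊥)))
    (hR : ∀ t y, Multiplicative.toAdd (R t y) =
      h1LimCongr (D.lDeltaTheta l) ⊤ (hφ t) ⊥
        (h1LimComap (phi C) (D.lDeltaTheta l) ((MonoidHom.id (Pi C)).comp (s t)) (hι t) (hN t)
          (AddEquiv.additiveMultiplicative (h1Lim (phi C) (D.lDeltaTheta l) (PiYdd C) ⊥) (Additive.ofMul y))))
    (t₀ : Lbl) (g : P₀) {y : Lbl → O}
    (hy : (fun t => R t (h1LimKummerOn (phi C) (D.lDeltaTheta l) (PiYdd C) c hA hfi O (y t))) ∈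
      (((thetaEnvData C hC hS hl hp2 hpl hζ mods f hf hmods h15 L hZ hcharY hlim).toRecord
        (h1LimConjMulAut (phi C) (D.lDeltaTheta l) (PiYdd C)) (h1LimKummerOn (phi C) (D.lDeltaTheta l) (PiYdd C) c hA hfi O)
        iota).inftyThetaMonoid i).map
        (MonoidHom.pi R)) :
    ∃ v : Lbl → O, (∀ t, IsOfFinOrder (v t)) ∧
      (fun t => R t (h1LimKummerOn (phi C) (D.lDeltaTheta l) (PiYdd C) c hA hfi O
          (v t * ⟨(s t g) • ((y t : O) : A), hO (s t g) _ (y t).2⟩))) ∈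
        (((thetaEnvData C hC hS hl hp2 hpl hζ mods f hf hmods h15 L hZ hcharY hlim).toRecord
        (h1LimConjMulAut (phi C) (D.lDeltaTheta l) (PiYdd C)) (h1LimKummerOn (phi C) (D.lDeltaTheta l) (PiYdd C) c hA hfi O)
        iota).inftyThetaMonoid i).map
          (MonoidHom.pi R) := by
  obtain ⟨z, hz, hzy⟩ := hy
  -- Cor 3.5 (ii) at `∞Ψ^{i}_env` (abc-iut-w4-d004, any inversion family): synchronization up to an `n`-torsion family `u`
  obtain ⟨n, u, hn, hun, hsync⟩ :=
    pi_restriction_inftyThetaMonoid_upToTorsion_toRecord_of_mem_thetaEnv C hC hS hl hp2 hpl hζ mods f hf hmods h15 L hZ hcharY hlim c hA hfi O hO iota φ₀ s hι hN hφ q hq w hsec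
      hθ i hroots R hR hz t₀ g
  -- each `u t` is the Kummer class of a root of unity `ζ t ∈ O` (abc-iut-w5-d098 + `hOtors`)
  have hv : ∀ t, ∃ ζ : A, IsOfFinOrder ζ ∧
      h1LimKummer (phi C) (D.lDeltaTheta l) (PiYdd C) c hA hfi ζ = u t := by
    intro t
    have hut₀ : IsOfFinOrder (u t) := isOfFinOrder_iff_pow_eq_one.mpr ⟨n, hn, hun t⟩
    have hut : IsOfFinAddOrder
        (Multiplicative.toAdd (α := h1Lim (phi C) (D.lDeltaTheta l) (PiYdd C) ⊥) (u t)) :=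
      (isOfFinOrder_ofAdd_iff (α := h1Lim (phi C) (D.lDeltaTheta l) (PiYdd C) ⊥)
        (x := Multiplicative.toAdd (α := h1Lim (phi C) (D.lDeltaTheta l) (PiYdd C) ⊥) (u t))).mp hut₀
    obtain ⟨ζr, hζr, hζreq⟩ :=
      exists_h1LimKummer_eq_of_isOfFinAddOrder (phi C) (D.lDeltaTheta l) (PiYdd C) c hA hfi hc _ hut
    exact ⟨ζr, hζr, hζreq⟩
  choose ζr hζr hζreq using hv
  refine ⟨fun t => ⟨ζr t, (hOtors (ζr t) (hζr t)).1⟩, fun t => ?_, ?_⟩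
  · obtain ⟨m, hm, hζm⟩ := (hζr t).exists_pow_eq_one
    exact isOfFinOrder_iff_pow_eq_one.mpr
      ⟨m, hm, Subtype.ext (by rw [SubmonoidClass.coe_pow, OneMemClass.coe_one]; exact hζm)⟩
  · -- the new tuple IS `∏ R_t (s_{t₀}(g) · z)`, and `s_{t₀}(g) · z ∈ ∞Ψ^{i}_env` (units stable, `hΘU`)
    have key : (fun t => R t (h1LimKummerOn (phi C) (D.lDeltaTheta l) (PiYdd C) c hA hfi O
        ((⟨ζr t, (hOtors (ζr t) (hζr t)).1⟩ : O) * ⟨(s t g) • ((y t : O) : A), hO (s t g) _ (y t).2⟩))) =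
        (fun t => R t (u t)) * piIso Lbl (h1LimConjMulAut φ₀ (D.lDeltaTheta l) ⊤ g)
          (fun t => R t (h1LimKummerOn (phi C) (D.lDeltaTheta l) (PiYdd C) c hA hfi O (y t))) := by
      funext t
      have hmul : R t (h1LimKummerOn (phi C) (D.lDeltaTheta l) (PiYdd C) c hA hfi O
          ((⟨ζr t, (hOtors (ζr t) (hζr t)).1⟩ : O) * ⟨(s t g) • ((y t : O) : A), hO (s t g) _ (y t).2⟩)) =
          R t (h1LimKummerOn (phi C) (D.lDeltaTheta l) (PiYdd C) c hA hfi O ⟨ζr t, (hOtors (ζr t) (hζr t)).1⟩) *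
          R t (h1LimKummerOn (phi C) (D.lDeltaTheta l) (PiYdd C) c hA hfi O
            ⟨(s t g) • ((y t : O) : A), hO (s t g) _ (y t).2⟩) :=
        (congrArg (R t) (map_mul (h1LimKummerOn (phi C) (D.lDeltaTheta l) (PiYdd C) c hA hfi O) _ _)).trans
          (map_mul (R t) _ _)
      have hκζ : R t (h1LimKummerOn (phi C) (D.lDeltaTheta l) (PiYdd C) c hA hfi O ⟨ζr t, (hOtors (ζr t) (hζr t)).1⟩) =
          R t (u t) := congrArg (R t) (hζreq t)
      change _ = R t (u t) * h1LimConjMulAut φ₀ (D.lDeltaTheta l) ⊤ g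
        (R t (h1LimKummerOn (phi C) (D.lDeltaTheta l) (PiYdd C) c hA hfi O (y t)))
      rw [hmul, hκζ,
        kummer_smul_restriction_eq_toRecord_family C hC hS hl hp2 hpl hζ mods f hf hmods h15 L hZ hcharY hlim c hA hfi O hO iota φ₀ s hι hN hφ R hR t g (y t)]
    have hzstab : ((thetaEnvData C hC hS hl hp2 hpl hζ mods f hf hmods h15 L hZ hcharY hlim).toRecord
        (h1LimConjMulAut (phi C) (D.lDeltaTheta l) (PiYdd C)) (h1LimKummerOn (phi C) (D.lDeltaTheta l) (PiYdd C) c hA hfi O)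
        iota).conj
        (s t₀ g) z ∈
        ((thetaEnvData C hC hS hl hp2 hpl hζ mods f hf hmods h15 L hZ hcharY hlim).toRecord
        (h1LimConjMulAut (phi C) (D.lDeltaTheta l) (PiYdd C)) (h1LimKummerOn (phi C) (D.lDeltaTheta l) (PiYdd C) c hA hfi O)
        iota).inftyThetaMonoid i :=
      splitMonoid_closure_conjStable
        ((thetaEnvData C hC hS hl hp2 hpl hζ mods f hf hmods h15 L hZ hcharY hlim).toRecord
        (h1LimConjMulAut (phi C) (D.lDeltaTheta l) (PiYdd C)) (h1LimKummerOn (phi C) (D.lDeltaTheta l) (PiYdd C) c hA hfi O)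
        iota).conj
        ((thetaEnvData C hC hS hl hp2 hpl hζ mods f hf hmods h15 L hZ hcharY hlim).toRecord
        (h1LimConjMulAut (phi C) (D.lDeltaTheta l) (PiYdd C)) (h1LimKummerOn (phi C) (D.lDeltaTheta l) (PiYdd C) c hA hfi O)
        iota).units
        (((thetaEnvData C hC hS hl hp2 hpl hζ mods f hf hmods h15 L hZ hcharY hlim).toRecord
        (h1LimConjMulAut (phi C) (D.lDeltaTheta l) (PiYdd C)) (h1LimKummerOn (phi C) (D.lDeltaTheta l) (PiYdd C) c hA hfi O)
        iota).inftyThetaEnv i)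
        (s t₀ g)
        (fun u' hu' => units_stable_toRecord_family C hC hS hl hp2 hpl hζ mods f hf hmods h15 L hZ hcharY hlim c hA hfi O hO iota (s t₀ g) u' hu')
        (hThetaU_toRecord_family C hC hS hl hp2 hpl hζ mods f hf hmods h15 L hZ hcharY hlim c hA hfi O hO iota s hN hc hOtors hOroot hθ i hroots g t₀)
        z hz
    rw [key, ← hzy, ← hsync]
    exact ⟨_, hzstab, rfl⟩

end EtaleLevels

end Literature.IUT.HodgeArakelov

end
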